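import Mathlib.LinearAlgebra.Span.Basic
import Mathlib.Algebra.Module.Submodule.Map
import Mathlib.Algebra.Module.Submodule.Ker
import Mathlib.Algebra.Module.Submodule.Range
import Mathlib.LinearAlgebra.Prod
import Mathlib.Tactic.Abel
import Mathlib.Tactic.Module
import Mathlib.Tactic.LinearCombination
import HarnessLib

/-!
# The `U_p`-eigenlattice of the `p`-old pair is the graph of `u₀ − T_p` (cell `b2b-bsdres`, seat additive-p4 gen 37, line V64 — the algebra of Proposition V64-B)

HONEST FRAMING (verbatim, cell `b2b-bsdres`): the goal of the cell is to DELETE the COMBINATION-SHAPED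
residual classes for ALL analytic-rank `≤ 1` curves over `ℚ` — "full BSD formula for every rank `≤ 1`
curve in class `C`" assembled STRICTLY from published theorems — so that the rank-`≤ 1` remainder
becomes exactly the CONSTRUCTION-SHAPED classes, which are TYPED (missing-input Props), NOT attempted;
this is not "finishing BSD". This file: TOOL theorems (pure module algebra; 0 defs, 0 facts, nothing
booked; X4 stays CONSTRUCTION-SHAPED; no mark moves).

## Why

Memo V64 §3 (Proposition V64-B): at the `p`-semistable level `pM` (`p ∤ M`) the `p`-old part of the
`𝔪`-block is `j′(K₀ × K₀)` (`K₀ = H₁(X₀(M))_𝔪`, `j′ = (d₁^*, d_p^*)` injective with saturated image —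
Ihara), and `U_p` acts on the pair through `𝒰(x, y) = (T_p x + y, −p x)` (q-expansions:
`U_p(f|B_p) = f`, `U_p f = T_p f − p·f|B_p`), characteristic polynomial `U² − T_pU + p`. When
`a_p(ρ̄) ≠ 0`, Hensel splits `U² − T_pU + p = (U − u₀)(U − u₁)` over `𝕋(M)_𝔪` with `u₀ ∈ 𝔪`, and the
`U_p`-topologically-nilpotent part of the block is `j′(ker(𝒰 − u₀))`. This file proves the algebra
behind "the nilpotent part IS the bottom lattice `K₀`, compatibly with the `ℓ_i`-old lattices":

* `mem_ker_pOldPairOp_sub_iff` (+ `mem_range_graphMap_iff`) : for ANY root `u₀` of `U² − tU + p` in a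
  commutative ring, `ker(𝒰 − u₀) = {(x, (u₀ − t)x)}` = the range of the graph map
  `φ(x) = (x, (u₀ − t)•x)`.
* `graphMap_injective`, `prod_inf_range_graphMap` : `φ` is injective and
  `(O × O) ⊓ range φ = φ(O)` for every submodule `O ≤ K₀` — so the `ℓ_i`-old lattice of the nilpotent
  part (the intersection of the old pair-lattice `O × O` with it) is the image of the bottom old lattice.
* `smul_mem_sup_map_graph_iff` : T-V54 transfers: `O₁ ⊔ O₂` is `r`-saturated in `K₀` iff
  `φ(O₁) ⊔ φ(O₂)` is `r`-saturated in `range φ`.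

No number theory enters; Ihara at `p`, Hensel, and the identification of the degeneracy maps are the
APPLICATION's inputs (memo V64 §3), displayed there.

## References (context only; the proofs are elementary)

* A. Wiles, Ann. of Math. 141 (1995), §2. [cite: Wiles1995, §2]
* K. Ribet, Proc. ICM 1983 (1984), Thm. 4.1. [cite: Ribet1984ICM, Thm. 4.1]
-/

namespace Summit.BirchSwinnertonDyer.Rank1Residual.LevelLowering

section POldPair

variable {R K : Type*} [CommRing R] [AddCommGroup K] [Module R K]

/-- The graph map `x ↦ (x, c • x)`. -/
theorem graphMap_injective (c : R) :
    Function.Injective (LinearMap.id.prod (c • LinearMap.id) : K →ₗ[R] K × K) := by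
  intro x y h
  have := congrArg Prod.fst h
  simpa using this

/-- Membership in the range of the graph map: `(x, y) ∈ range φ_c ↔ y = c • x`. -/
theorem mem_range_graphMap_iff (c : R) (w : K × K) :
    w ∈ LinearMap.range (LinearMap.id.prod (c • LinearMap.id) : K →ₗ[R] K × K) ↔ w.2 = c • w.1 := by
  constructor
  · rintro ⟨x, rfl⟩
    simp
  · intro h
    refine ⟨w.1, ?_⟩
    ext <;> simp [h]

/-- **`ker(𝒰 − u₀)` is the graph of `u₀ − t`.** The operator of the `p`-old pair,
`𝒰(x, y) = (t • x + y, −(p • x))` (`t = T_p`), and a root `u₀` of `U² − tU + p`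
(`u₀ * u₀ = t * u₀ − p`): `(x, y) ∈ ker(𝒰 − u₀) ↔ y = (u₀ − t) • x`. (Memo V64 §3 (B2).)
[cite: Wiles1995, §2] -/
theorem mem_ker_pOldPairOp_sub_iff (t p u₀ : R) (hu : u₀ * u₀ = t * u₀ - p) (w : K × K) :
    (t • w.1 + w.2 = u₀ • w.1 ∧ -(p • w.1) = u₀ • w.2) ↔ w.2 = (u₀ - t) • w.1 := by
  constructor
  · rintro ⟨h1, _⟩
    rw [sub_smul]
    rw [← h1]
    abel
  · intro h
    refine ⟨?_, ?_⟩
    · rw [h, sub_smul]; abel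
    · rw [h, smul_smul, mul_sub, hu]
      simp only [sub_smul, mul_smul]
      -- goal: -(p • w.1) = t • u₀ • w.1 - p • w.1 - t • u₀ • w.1  (after unfolding)
      module

/-- **The old lattice of the nilpotent part is the image of the bottom old lattice**:
`(O × O) ⊓ range φ_c = φ_c(O)` for the graph map `φ_c(x) = (x, c • x)`. -/
theorem prod_inf_range_graphMap (c : R) (O : Submodule R K) :
    O.prod O ⊓ LinearMap.range (LinearMap.id.prod (c • LinearMap.id) : K →ₗ[R] K × K)
      = O.map (LinearMap.id.prod (c • LinearMap.id) : K →ₗ[R] K × K) := by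
  ext w
  constructor
  · rintro ⟨hO, hr⟩
    rw [SetLike.mem_coe, Submodule.mem_prod] at hO
    rw [SetLike.mem_coe, mem_range_graphMap_iff] at hr
    refine ⟨w.1, hO.1, ?_⟩
    ext <;> simp [hr]
  · rintro ⟨x, hx, rfl⟩
    refine ⟨?_, ?_⟩
    · rw [SetLike.mem_coe, Submodule.mem_prod]
      exact ⟨by simpa using hx, by simpa using O.smul_mem c hx⟩
    · exact LinearMap.mem_range_self _ x

/-- **T-V54 transfers along the graph map**: for submodules `O₁ O₂ ≤ K` and a scalar `r`,
`O₁ ⊔ O₂` is `r`-saturated in `K` iff `φ_c(O₁) ⊔ φ_c(O₂)` is `r`-saturated in `range φ_c`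
(two-prime old-space saturation of the bottom lattice ⟺ of the `U_p`-nilpotent part, memo V64 §3).
[cite: Ribet1984ICM, Thm. 4.1] -/
theorem smul_mem_sup_map_graph_iff (c r : R) (O₁ O₂ : Submodule R K) :
    (∀ x : K, r • x ∈ O₁ ⊔ O₂ → x ∈ O₁ ⊔ O₂) ↔
    (∀ w ∈ LinearMap.range (LinearMap.id.prod (c • LinearMap.id) : K →ₗ[R] K × K),
        r • w ∈ (O₁ ⊔ O₂).map (LinearMap.id.prod (c • LinearMap.id) : K →ₗ[R] K × K) →
        w ∈ (O₁ ⊔ O₂).map (LinearMap.id.prod (c • LinearMap.id) : K →ₗ[R] K × K)) := by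
  set φ : K →ₗ[R] K × K := LinearMap.id.prod (c • LinearMap.id) with hφ
  have hinj : Function.Injective φ := graphMap_injective c
  constructor
  · intro hsat w hw hrw
    obtain ⟨x, rfl⟩ := LinearMap.mem_range.mp hw
    obtain ⟨y, hy, hyx⟩ := Submodule.mem_map.mp hrw
    have : y = r • x := hinj (by rw [hyx, map_smul])
    rw [this] at hy
    exact Submodule.mem_map_of_mem (hsat x hy)
  · intro hsat x hx
    have h1 : r • φ x ∈ (O₁ ⊔ O₂).map φ := by
      rw [← map_smul]; exact Submodule.mem_map_of_mem hx
    obtain ⟨y, hy, hyx⟩ := Submodule.mem_map.mp (hsat (φ x) (LinearMap.mem_range_self φ x) h1)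
    have : y = x := hinj hyx
    rw [this] at hy
    exact hy

end POldPair

end Summit.BirchSwinnertonDyer.Rank1Residual.LevelLowering
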